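import Summits.RiemannHypothesis.RiemannHypothesis.Theorems.SoninPolyEta
import Summits.RiemannHypothesis.RiemannHypothesis.Theorems.SoninCertEps
import Literature.Analysis.FunctionSpaces.PlancherelL1L2
import HarnessLib

/-!
# Band energy of a polynomial Sonin-section vector: `∫_{[−1,1]} |𝓕 η_{r,X}|² ≤ ε` from a kernel check — generic in `(r, X)`

Cell `rh-explicit`, seat cc-s2-1 (sub-line (ii), S = {∞, 2}).  GENERIC form of cc-s2-3's file `SoninCertEps` (P3,
hard-wired to `rL`, `X = 8`, Taylor order `230`): for any coefficient list `r`, rational end point `X ≥ 1` and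
half-order `N`, the hypothesis `hε` of cc-s2-1's frame entry point
(`SoninFrameBridge.not_semilocalSoninIneqOn_two_of_polyWitness_frame`) for the vector `polyEta r X` of
`SoninPolyEta` follows from the Boolean check `checkPolyEps r X N ε = true`.
Route (as in P3): `𝓕η(ξ) = ∫_{[−X,X]} e^{−2πixξ} η(x) dx = Σ_{k<2N} ((−2πiξ)^k/k!) m_k + ρ(ξ)`,
`m_k = (1 + (−1)^k)∫₁^X x^k R` (`momX`, exact rationals), `|ρ| ≤ 2(2πX)^{2N}/(2N)! · ∫|η| ≤ rhoBound`
(`Complex.exp_bound'`, usable once `13X ≤ 2N + 1`); the main term is the REAL even polynomial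
`T(ξ) = ev (polyTaylorL r X N) ((πξ)²)`; `|𝓕η|² ≤ (11/10)T² + 11ρ²`; `∫_{−1}^{1} T² = ev (yT2 (T·T)) (π²)`
(E1's `integral_ev_sq`), enclosed by E1's interval Horner at `π²/16` (MI.pi at scale `S`); the check
closes `(11/10)·∫T² + 22ρ² ≤ ε`, at a caller-chosen fixed-point scale `S` (the scale must beat the cancellation in `T·T`,
whose coefficients reach `absBound r X·(2πX)^{2πX}/⌊2πX⌋!`; P3's `2^192` suffices for degree 34 on `[1,8]`, degree 74 on `[1,12]`
needs ≈ `2^480`).  Definitions: `momX`, `polyTaylorL`, `rhoBound`, `piSqOver16`, `checkPolyEps` (certificate bookkeeping).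
No facts, no axioms.
-/

set_option linter.dupNamespace false  -- the mandated namespace repeats `RiemannHypothesis`

noncomputable section

open MeasureTheory Complex Set Finset
open scoped Real FourierTransform
open Summit.RiemannHypothesis.RiemannHypothesis.Theorems.SemilocalPolyWitness
open Summit.RiemannHypothesis.RiemannHypothesis.Theorems.MotivicDoor
open Summit.RiemannHypothesis.RiemannHypothesis.BandEnergy
open Literature.Analysis.ValidatedNumerics Literature.Analysis.ValidatedNumerics.NumericsMP

namespace Summit.RiemannHypothesis.RiemannHypothesis.SoninPoly

/-! ## Moments of `η_{r,X}` -/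

/-- `momX l X k = ∫₁^X x^k l(x) dx` (kernel-computable recursion). [folklore] -/
def momX : List ℚ → ℚ → ℕ → ℚ
  | [], _, _ => 0
  | a :: as, X, k => a * ((X ^ (k + 1) - 1) / (k + 1)) + momX as X (k + 1)

/-- `momX l X k = ∫₁^X x^k l(x) dx`. [folklore] -/
theorem momX_eq_integral (X : ℚ) : ∀ (l : List ℚ) (k : ℕ),
    ((momX l X k : ℚ) : ℝ) = ∫ x in (1 : ℝ)..X, x ^ k * LQ.ev l x
  | [], k => by simp [momX]
  | a :: as, k => by
      have ih := momX_eq_integral X as (k + 1)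
      have h1 : (fun x : ℝ => x ^ k * LQ.ev (a :: as) x) = fun x : ℝ => (a : ℝ) * x ^ k + x ^ (k + 1) * LQ.ev as x := by
        funext x; rw [LQ.ev_cons]; ring
      have i1 : IntervalIntegrable (fun x : ℝ => (a : ℝ) * x ^ k) volume (1 : ℝ) X :=
        (continuous_const.mul (continuous_pow k)).intervalIntegrable _ _
      have i2 : IntervalIntegrable (fun x : ℝ => x ^ (k + 1) * LQ.ev as x) volume (1 : ℝ) X :=
        ((continuous_pow (k + 1)).mul (LQ.continuous_ev as)).intervalIntegrable _ _
      rw [h1, intervalIntegral.integral_add i1 i2, ← ih, intervalIntegral.integral_const_mul, integral_pow, momX]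
      push_cast
      rw [one_pow]

variable (r : List ℚ) {X : ℚ}

/-- **The moments of `η_{r,X}`**: `∫_{[−X,X]} x^k η(x) dx = (1 + (−1)^k) ∫₁^X x^k R(x) dx` (for `1 ≤ X`). [folklore] -/
theorem setIntegral_pow_mul_polyEtaFun (hX : (1 : ℚ) ≤ X) (k : ℕ) :
    ∫ x in Icc (-(X : ℝ)) X, (x : ℂ) ^ k * polyEtaFun r X x = ((((1 + (-1) ^ k) * momX r X k : ℚ) : ℝ) : ℂ) := by
  have hX' : (1 : ℝ) ≤ (X : ℝ) := by exact_mod_cast hX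
  rw [setIntegral_eq_integral_of_forall_compl_eq_zero (fun x hx => by
    rw [polyEtaFun_eq_zero_of_not_mem r X hx, mul_zero])]
  have hsplit : (fun x : ℝ => (x : ℂ) ^ k * polyEtaFun r X x)
      = (Icc (1 : ℝ) X).indicator (fun x => (((x ^ k * LQ.ev r x : ℝ)) : ℂ))
        + (Icc (-(X : ℝ)) (-1)).indicator (fun x => (((x ^ k * LQ.ev r (-x) : ℝ)) : ℂ)) := by
    funext x
    simp only [Pi.add_apply]
    by_cases h1 : x ∈ Icc (1 : ℝ) X
    · have h2 : x ∉ Icc (-(X : ℝ)) (-1) := fun h => by linarith [h.2, h1.1]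
      rw [indicator_of_mem h1, indicator_of_notMem h2, add_zero, polyEtaFun_of_mem r X h1]; push_cast; ring
    · by_cases h2 : x ∈ Icc (-(X : ℝ)) (-1)
      · have h1' : -x ∈ Icc (1 : ℝ) X := ⟨by linarith [h2.2], by linarith [h2.1]⟩
        rw [indicator_of_notMem h1, indicator_of_mem h2, zero_add, ← polyEtaFun_neg, polyEtaFun_of_mem r X h1']
        push_cast; ring
      · rw [indicator_of_notMem h1, indicator_of_notMem h2, add_zero, polyEtaFun_eq_zero_of_not_mem_two r X h1 h2,
          mul_zero]
  have hc1 : Continuous fun x : ℝ => (((x ^ k * LQ.ev r x : ℝ)) : ℂ) :=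
    Complex.continuous_ofReal.comp ((continuous_pow k).mul (LQ.continuous_ev _))
  have hc2 : Continuous fun x : ℝ => (((x ^ k * LQ.ev r (-x) : ℝ)) : ℂ) :=
    Complex.continuous_ofReal.comp ((continuous_pow k).mul ((LQ.continuous_ev _).comp continuous_neg))
  rw [hsplit, integral_add' (hc1.integrableOn_Icc.integrable_indicator measurableSet_Icc)
    (hc2.integrableOn_Icc.integrable_indicator measurableSet_Icc), integral_indicator measurableSet_Icc,
    integral_indicator measurableSet_Icc, integral_complex_ofReal, integral_complex_ofReal,
    integral_Icc_eq_integral_Ioc, ← intervalIntegral.integral_of_le hX',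
    integral_Icc_eq_integral_Ioc, ← intervalIntegral.integral_of_le (by linarith : (-(X : ℝ)) ≤ -1),
    ← momX_eq_integral]
  have hneg : ∫ x in (-(X : ℝ))..(-1), x ^ k * LQ.ev r (-x) = (-1) ^ k * ∫ x in (1 : ℝ)..X, x ^ k * LQ.ev r x := by
    have h := intervalIntegral.integral_comp_neg (a := (-(X : ℝ))) (b := -1) (fun y => (-y) ^ k * LQ.ev r y)
    simp only [neg_neg] at h
    rw [h, ← intervalIntegral.integral_const_mul]
    refine intervalIntegral.integral_congr fun x _ => ?_
    simp only [neg_pow x k]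
    ring
  rw [hneg, ← momX_eq_integral]
  push_cast; ring

/-! ## The Taylor step on `[−X, X]` -/

/-- **Taylor step** on `[−X, X]`: for `g ∈ L¹[−X,X]`, `|ξ| ≤ 1`, `0 ≤ X` and `13X ≤ n + 1`,
`‖∫ e^{−2πixξ} g − Σ_{k<n} ((−2πiξ)^k/k!) ∫ x^k g‖ ≤ 2(2Xπ)^n/n! · ∫‖g‖`. [folklore] -/
theorem norm_setIntegral_fourierKernel_sub_taylor_leX {g : ℝ → ℂ} (hX0 : (0 : ℚ) ≤ X)
    (hg : IntegrableOn g (Icc (-(X : ℝ)) X)) {ξ : ℝ} (hξ : |ξ| ≤ 1) {n : ℕ} (hn : 13 * X ≤ (n : ℚ) + 1) :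
    ‖(∫ x in Icc (-(X : ℝ)) X, cexp (↑(-2 * π * x * ξ) * I) * g x)
        - ∑ k ∈ range n, (↑(-2 * π * ξ) * I) ^ k / (k.factorial : ℂ)
            * ∫ x in Icc (-(X : ℝ)) X, (x : ℂ) ^ k * g x‖
      ≤ 2 * (2 * X * π) ^ n / n.factorial * ∫ x in Icc (-(X : ℝ)) X, ‖g x‖ := by
  have hXr : (0 : ℝ) ≤ (X : ℝ) := by exact_mod_cast hX0
  set z : ℂ := ↑(-2 * π * ξ) * I with hz
  have hzn : ‖z‖ ≤ 2 * π := by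
    rw [hz, norm_mul, Complex.norm_I, mul_one, Complex.norm_real, Real.norm_eq_abs]
    rw [show -2 * π * ξ = -(2 * π * ξ) by ring, abs_neg, abs_mul, abs_of_pos Real.two_pi_pos]
    nlinarith [Real.pi_pos]
  have hIk : ∀ k : ℕ, IntegrableOn (fun x : ℝ => (x : ℂ) ^ k * g x) (Icc (-(X : ℝ)) X) := fun k =>
    IntegrableOn.continuousOn_mul (by fun_prop) hg isCompact_Icc
  have hIe : IntegrableOn (fun x : ℝ => cexp (↑(-2 * π * x * ξ) * I) * g x) (Icc (-(X : ℝ)) X) :=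
    IntegrableOn.continuousOn_mul (by fun_prop) hg isCompact_Icc
  have hIs : IntegrableOn (fun x : ℝ => (∑ k ∈ range n, ((x : ℂ) * z) ^ k / (k.factorial : ℂ)) * g x)
      (Icc (-(X : ℝ)) X) :=
    IntegrableOn.continuousOn_mul (by fun_prop) hg isCompact_Icc
  have hsum : ∑ k ∈ range n, z ^ k / (k.factorial : ℂ) * ∫ x in Icc (-(X : ℝ)) X, (x : ℂ) ^ k * g x
      = ∫ x in Icc (-(X : ℝ)) X, (∑ k ∈ range n, ((x : ℂ) * z) ^ k / (k.factorial : ℂ)) * g x := by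
    have hc : ∀ k ∈ range n, z ^ k / (k.factorial : ℂ) * ∫ x in Icc (-(X : ℝ)) X, (x : ℂ) ^ k * g x
        = ∫ x in Icc (-(X : ℝ)) X, z ^ k / (k.factorial : ℂ) * ((x : ℂ) ^ k * g x) :=
      fun k _ => (integral_const_mul _ _).symm
    rw [Finset.sum_congr rfl hc, ← integral_finsetSum _ fun k _ => (hIk k).const_mul (z ^ k / (k.factorial : ℂ))]
    refine integral_congr_ae (Filter.Eventually.of_forall fun x => ?_)
    simp only
    rw [Finset.sum_mul]
    exact Finset.sum_congr rfl fun k _ => by rw [mul_pow]; ring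
  have hexp : ∀ x : ℝ, cexp (↑(-2 * π * x * ξ) * I) = cexp ((x : ℂ) * z) := fun x => by
    rw [hz]; congr 1; push_cast; ring
  rw [hsum, ← integral_sub hIe hIs]
  have hpt : ∀ x ∈ Icc (-(X : ℝ)) X,
      ‖cexp (↑(-2 * π * x * ξ) * I) * g x - (∑ k ∈ range n, ((x : ℂ) * z) ^ k / (k.factorial : ℂ)) * g x‖
        ≤ 2 * (2 * X * π) ^ n / n.factorial * ‖g x‖ := by
    intro x hx
    have hx1 : |x| ≤ X := abs_le.2 ⟨hx.1, hx.2⟩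
    have hxz : ‖(x : ℂ) * z‖ ≤ 2 * X * π := by
      rw [norm_mul, Complex.norm_real, Real.norm_eq_abs]
      calc |x| * ‖z‖ ≤ X * (2 * π) := by gcongr
        _ = 2 * X * π := by ring
    have hcond : ‖(x : ℂ) * z‖ / (n.succ : ℕ) ≤ 1 / 2 := by
      rw [div_le_iff₀ (by positivity)]
      have hn' : 13 * (X : ℝ) ≤ (n.succ : ℕ) := by
        have : ((13 * X : ℚ) : ℝ) ≤ (((n : ℚ) + 1 : ℚ) : ℝ) := by exact_mod_cast hn
        push_cast at this
        simpa using this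
      nlinarith [two_pi_le, Real.pi_pos]
    have hb := Complex.exp_bound' (x := (x : ℂ) * z) (n := n) hcond
    rw [hexp x, ← sub_mul, norm_mul]
    calc ‖cexp ((x : ℂ) * z) - ∑ k ∈ range n, ((x : ℂ) * z) ^ k / (k.factorial : ℂ)‖ * ‖g x‖
        ≤ ‖(x : ℂ) * z‖ ^ n / n.factorial * 2 * ‖g x‖ := by gcongr
      _ ≤ (2 * X * π) ^ n / n.factorial * 2 * ‖g x‖ := by gcongr
      _ = 2 * (2 * X * π) ^ n / n.factorial * ‖g x‖ := by ring
  calc ‖∫ x in Icc (-(X : ℝ)) X, (cexp (↑(-2 * π * x * ξ) * I) * g x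
          - (∑ k ∈ range n, ((x : ℂ) * z) ^ k / (k.factorial : ℂ)) * g x)‖
      ≤ ∫ x in Icc (-(X : ℝ)) X, ‖cexp (↑(-2 * π * x * ξ) * I) * g x
          - (∑ k ∈ range n, ((x : ℂ) * z) ^ k / (k.factorial : ℂ)) * g x‖ :=
        norm_integral_le_integral_norm _
    _ ≤ ∫ x in Icc (-(X : ℝ)) X, 2 * (2 * X * π) ^ n / n.factorial * ‖g x‖ :=
        setIntegral_mono_on (hIe.sub hIs).norm (hg.norm.const_mul _) measurableSet_Icc hpt
    _ = 2 * (2 * X * π) ^ n / n.factorial * ∫ x in Icc (-(X : ℝ)) X, ‖g x‖ := integral_const_mul _ _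

/-! ## The certificate data and the kernel check -/

/-- The compressed (even) Taylor coefficients of `𝓕η_{r,X}` in `u = (πξ)²`:
`c_j = (−4)^j · 2∫₁^X x^{2j}R / (2j)!`, `j < N`. [folklore] -/
def polyTaylorL (r : List ℚ) (X : ℚ) (N : ℕ) : List ℚ :=
  (List.range N).map fun j => (-4) ^ j * (2 * momX r X (2 * j)) / (2 * j).factorial

/-- Rational bound of the Taylor remainder: `2(2X·3.1416)^{2N}/(2N)! · (2X · absBound r X) ≥ |ρ(ξ)|`. [folklore] -/
def rhoBound (r : List ℚ) (X : ℚ) (N : ℕ) : ℚ :=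
  2 * (2 * X * (31416 / 10000 : ℚ)) ^ (2 * N) / (2 * N).factorial * (2 * X * LQ.absBound r X)

/-- The enclosure of `π²/16` at fixed-point scale `S` from `K` Machin terms (`none` if the engine refuses). [folklore] -/
def piSqOver16 (S K : ℕ) : Option MI := (MI.pi S K).map fun P => (MI.sqr S P).divNat 16

/-- **The check** at fixed-point scale `S` with `K` Machin terms for `π`: `0 < S`, `13X ≤ 2N + 1` and, with
`H ∋ S·∫_{−1}^{1} T²` (interval Horner of `yT2 (T·T)` at `π²/16`), `(11/10)·H.hi + 22·rhoBound²·S ≤ ε·S`.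
(The scale must beat the cancellation in `T·T`: coefficients up to `absBound r X · (2πX)^{2πX}/(2πX)!`.) [folklore] -/
def checkPolyEps (r : List ℚ) (X : ℚ) (N S K : ℕ) (eps : ℚ) : Bool :=
  match piSqOver16 S K with
  | none => false
  | some U =>
    let T := polyTaylorL r X N
    let H := hornerMI S (scaleList (yT2 (LQ.mul T T)) 16) U
    decide (0 < S) && decide (13 * X ≤ (2 * N : ℕ) + 1) &&
      decide ((11 / 10 : ℚ) * H.hi + 22 * rhoBound r X N ^ 2 * S ≤ eps * S)

/-- Membership of `π²/16` in `piSqOver16 S K` whenever the engine returns `some`. [folklore] -/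
theorem piSqOver16_mem {S K : ℕ} (hS : 0 < S) {U : MI} (hU : piSqOver16 S K = some U) :
    MI.mem S (π ^ 2 / 16) U := by
  obtain ⟨P, hP, rfl⟩ := Option.map_eq_some_iff.1 hU
  have h2 := MI.mem_divNat (MI.mem_sqr hS (MI.mem_pi S hP)) (n := 16) (by norm_num)
  convert h2 using 2
  norm_num

/-! ## Soundness -/

/-- The main term as a sum: `ev (polyTaylorL r X N) u = Σ_{j<N} c_j u^j`. [folklore] -/
theorem ev_polyTaylorL (X : ℚ) (N : ℕ) (u : ℝ) : LQ.ev (polyTaylorL r X N) u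
    = ∑ j ∈ range N, (((-4) ^ j * (2 * momX r X (2 * j)) / (2 * j).factorial : ℚ) : ℝ) * u ^ j := by
  rw [LQ.ev_eq_sum, show (polyTaylorL r X N).length = N by simp [polyTaylorL]]
  refine Finset.sum_congr rfl fun j hj => ?_
  rw [polyTaylorL, getD_map_range _ (Finset.mem_range.1 hj)]

/-- **The Taylor main term is real and even**: `Σ_{k<2N} ((−2πiξ)^k/k!)·m_k = ev (polyTaylorL r X N) ((πξ)²)`.
[folklore] -/
theorem taylorSum_eq_ev_polyTaylorL (X : ℚ) (N : ℕ) (ξ : ℝ) :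
    ∑ k ∈ range (2 * N), (↑(-2 * π * ξ) * I) ^ k / (k.factorial : ℂ) * ((((1 + (-1) ^ k) * momX r X k : ℚ) : ℝ) : ℂ)
      = (LQ.ev (polyTaylorL r X N) ((π * ξ) ^ 2) : ℂ) := by
  have hw : ∀ k : ℕ, ((↑(-2 * π * ξ) * I : ℂ)) ^ k = (-2 * ((π * ξ : ℝ) : ℂ) * I) ^ k := fun k => by
    push_cast; ring
  have key : ∀ M : ℕ, ∑ k ∈ range (2 * M), (↑(-2 * π * ξ) * I) ^ k / (k.factorial : ℂ)
      * ((((1 + (-1) ^ k) * momX r X k : ℚ) : ℝ) : ℂ)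
      = ((∑ j ∈ range M, ((((-4) ^ j * (2 * momX r X (2 * j)) / (2 * j).factorial : ℚ) : ℝ)
          * ((π * ξ) ^ 2) ^ j) : ℝ) : ℂ) := by
    intro M
    induction M with
    | zero => simp
    | succ M ih =>
        rw [show 2 * (M + 1) = 2 * M + 1 + 1 by ring, Finset.sum_range_succ, Finset.sum_range_succ, ih,
          Finset.sum_range_succ, hw, hw, neg_two_mul_I_pow_even, neg_two_mul_I_pow_odd]
        push_cast
        have h1 : ((-1 : ℂ)) ^ (2 * M) = 1 := by rw [pow_mul]; norm_num
        have h2 : ((-1 : ℂ)) ^ (2 * M + 1) = -1 := by rw [pow_succ, h1]; norm_num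
        have h3 : ((2 : ℂ)) ^ (2 * M) = 4 ^ M := by rw [pow_mul]; norm_num
        have h4 : ((-4 : ℂ)) ^ M = (-1) ^ M * 4 ^ M := neg_pow 4 M
        rw [h1, h2, h3, h4]
        ring
  rw [key N, ev_polyTaylorL]

/-- `η_{r,X} ∈ L¹(ℝ)` (for `0 ≤ X`). [folklore] -/
theorem integrable_polyEtaFun (hX0 : (0 : ℚ) ≤ X) : Integrable (polyEtaFun r X) :=
  SemilocalMarkov.integrable_of_norm_le_of_eq_zero (C := (LQ.absBound r X : ℝ)) (R := X)
    (measurable_polyEtaFun r X).aestronglyMeasurable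
    (fun x => by
      by_cases hx : x ∈ Icc (-(X : ℝ)) X
      · rw [polyEtaFun, indicator_of_mem hx]; exact norm_polyEtaCore_le r X hX0 hx
      · rw [polyEtaFun_eq_zero_of_not_mem r X hx, norm_zero]; exact_mod_cast LQ.absBound_nonneg r hX0)
    (fun x hx => polyEtaFun_eq_zero_of_not_mem r X fun h => by
      have := abs_le.2 ⟨by linarith [h.1], h.2⟩; linarith)

/-- `∫_{[−X,X]} ‖η‖ ≤ 2X · absBound r X` (for `0 ≤ X`). [folklore] -/
theorem setIntegral_norm_polyEtaFun_le (hX0 : (0 : ℚ) ≤ X) :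
    ∫ x in Icc (-(X : ℝ)) X, ‖polyEtaFun r X x‖ ≤ 2 * X * (LQ.absBound r X : ℝ) := by
  have hXr : (0 : ℝ) ≤ (X : ℝ) := by exact_mod_cast hX0
  have hb : ∀ x ∈ Icc (-(X : ℝ)) X, ‖polyEtaFun r X x‖ ≤ (LQ.absBound r X : ℝ) := fun x hx => by
    rw [polyEtaFun, indicator_of_mem hx]; exact norm_polyEtaCore_le r X hX0 hx
  calc ∫ x in Icc (-(X : ℝ)) X, ‖polyEtaFun r X x‖ ≤ ∫ x in Icc (-(X : ℝ)) X, (LQ.absBound r X : ℝ) :=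
        setIntegral_mono_on (integrable_polyEtaFun r hX0).norm.integrableOn (by simp) measurableSet_Icc hb
    _ = 2 * X * (LQ.absBound r X : ℝ) := by
        rw [setIntegral_const, smul_eq_mul, Measure.real, Real.volume_Icc,
          ENNReal.toReal_ofReal (by linarith)]
        ring

/-- `𝓕η(ξ) = ∫_{[−X,X]} e^{−2πixξ} η(x) dx`. [folklore] -/
theorem fourier_polyEtaFun_eq (X : ℚ) (ξ : ℝ) :
    𝓕 (polyEtaFun r X) ξ = ∫ x in Icc (-(X : ℝ)) X, cexp (↑(-2 * π * x * ξ) * I) * polyEtaFun r X x := by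
  rw [Real.fourier_real_eq_integral_exp_smul]
  simp only [smul_eq_mul]
  exact (setIntegral_eq_integral_of_forall_compl_eq_zero fun x hx => by
    rw [polyEtaFun_eq_zero_of_not_mem r X hx, mul_zero]).symm

/-- **Pointwise remainder bound**: `‖𝓕η(ξ) − T(ξ)‖ ≤ rhoBound r X N` for `|ξ| ≤ 1` (`1 ≤ X`, `13X ≤ 2N + 1`).
[folklore] -/
theorem norm_fourier_polyEtaFun_sub_le (hX : (1 : ℚ) ≤ X) {N : ℕ} (hN : 13 * X ≤ (2 * N : ℕ) + 1)
    {ξ : ℝ} (hξ : |ξ| ≤ 1) :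
    ‖𝓕 (polyEtaFun r X) ξ - (LQ.ev (polyTaylorL r X N) ((π * ξ) ^ 2) : ℂ)‖ ≤ (rhoBound r X N : ℝ) := by
  have hX0 : (0 : ℚ) ≤ X := by linarith
  have hXr : (0 : ℝ) ≤ (X : ℝ) := by exact_mod_cast hX0
  have hN' : 13 * X ≤ ((2 * N : ℕ) : ℚ) + 1 := by exact_mod_cast hN
  have ht := norm_setIntegral_fourierKernel_sub_taylor_leX hX0 (integrable_polyEtaFun r hX0).integrableOn hξ hN'
  simp_rw [setIntegral_pow_mul_polyEtaFun r hX] at ht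
  rw [taylorSum_eq_ev_polyTaylorL, ← fourier_polyEtaFun_eq] at ht
  refine ht.trans ?_
  have hπ : π ≤ 31416 / 10000 := by have := Real.pi_lt_d4; norm_num at this ⊢; linarith
  have h1 : 2 * (2 * X * π) ^ (2 * N) / (Nat.factorial (2 * N) : ℝ)
      ≤ ((2 * (2 * X * (31416 / 10000 : ℚ)) ^ (2 * N) / (2 * N).factorial : ℚ) : ℝ) := by
    push_cast; gcongr
  have h0 : (0 : ℝ) ≤ ∫ x in Icc (-(X : ℝ)) X, ‖polyEtaFun r X x‖ := integral_nonneg fun _ => norm_nonneg _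
  rw [rhoBound]
  push_cast at h1 ⊢
  calc 2 * (2 * X * π) ^ (2 * N) / (Nat.factorial (2 * N) : ℝ) * ∫ x in Icc (-(X : ℝ)) X, ‖polyEtaFun r X x‖
      ≤ (2 * (2 * X * (31416 / 10000 : ℝ)) ^ (2 * N) / (Nat.factorial (2 * N) : ℝ))
          * ∫ x in Icc (-(X : ℝ)) X, ‖polyEtaFun r X x‖ :=
        mul_le_mul_of_nonneg_right h1 h0
    _ ≤ (2 * (2 * X * (31416 / 10000 : ℝ)) ^ (2 * N) / (Nat.factorial (2 * N) : ℝ)) * (2 * X * (LQ.absBound r X : ℝ)) :=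
        mul_le_mul_of_nonneg_left (setIntegral_norm_polyEtaFun_le r hX0) (by positivity)

/-- **Pointwise energy bound**: `‖𝓕η(ξ)‖² ≤ (11/10)·T(ξ)² + 11·ρ²` for `|ξ| ≤ 1`. [folklore] -/
theorem norm_sq_fourier_polyEtaFun_le (hX : (1 : ℚ) ≤ X) {N : ℕ} (hN : 13 * X ≤ (2 * N : ℕ) + 1)
    {ξ : ℝ} (hξ : |ξ| ≤ 1) :
    ‖𝓕 (polyEtaFun r X) ξ‖ ^ 2
      ≤ (11 / 10) * (LQ.ev (polyTaylorL r X N) ((π * ξ) ^ 2)) ^ 2 + 11 * (rhoBound r X N : ℝ) ^ 2 := by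
  set T : ℝ := LQ.ev (polyTaylorL r X N) ((π * ξ) ^ 2)
  have h1 : ‖𝓕 (polyEtaFun r X) ξ‖ ≤ |T| + rhoBound r X N := by
    have h := norm_fourier_polyEtaFun_sub_le r hX hN hξ
    have := norm_le_norm_add_norm_sub' (𝓕 (polyEtaFun r X) ξ) (T : ℂ)
    rw [Complex.norm_real, Real.norm_eq_abs] at this
    linarith
  calc ‖𝓕 (polyEtaFun r X) ξ‖ ^ 2 ≤ (|T| + rhoBound r X N) ^ 2 := pow_le_pow_left₀ (norm_nonneg _) h1 2
    _ ≤ (11 / 10) * T ^ 2 + 11 * (rhoBound r X N : ℝ) ^ 2 := by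
        rw [← sq_abs T]; nlinarith [sq_nonneg (|T| - 10 * rhoBound r X N), sq_abs T]

/-- **The band energy of `η_{r,X}` (function form)**:
`∫_{[−1,1]} ‖𝓕η‖² ≤ (11/10)·(yT2 (T·T))(π²) + 22ρ²`. [folklore] -/
theorem integral_norm_sq_fourier_polyEtaFun_le (hX : (1 : ℚ) ≤ X) {N : ℕ} (hN : 13 * X ≤ (2 * N : ℕ) + 1) :
    ∫ ξ in Icc (-1 : ℝ) 1, ‖𝓕 (polyEtaFun r X) ξ‖ ^ 2
      ≤ (11 / 10) * LQ.ev (yT2 (LQ.mul (polyTaylorL r X N) (polyTaylorL r X N))) (π ^ 2)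
        + 22 * (rhoBound r X N : ℝ) ^ 2 := by
  have hX0 : (0 : ℚ) ≤ X := by linarith
  set TL := polyTaylorL r X N
  have hcF : Continuous fun ξ : ℝ => 𝓕 (polyEtaFun r X) ξ :=
    VectorFourier.fourierIntegral_continuous Real.continuous_fourierChar (by fun_prop)
      (integrable_polyEtaFun r hX0)
  have hcT : Continuous fun ξ : ℝ => (11 / 10) * (LQ.ev TL ((π * ξ) ^ 2)) ^ 2 + 11 * (rhoBound r X N : ℝ) ^ 2 := by
    have := LQ.continuous_ev TL; fun_prop
  calc ∫ ξ in Icc (-1 : ℝ) 1, ‖𝓕 (polyEtaFun r X) ξ‖ ^ 2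
      ≤ ∫ ξ in Icc (-1 : ℝ) 1, ((11 / 10) * (LQ.ev TL ((π * ξ) ^ 2)) ^ 2 + 11 * (rhoBound r X N : ℝ) ^ 2) :=
        setIntegral_mono_on ((hcF.norm.pow 2).integrableOn_Icc) hcT.integrableOn_Icc measurableSet_Icc
          fun ξ hξ => norm_sq_fourier_polyEtaFun_le r hX hN (abs_le.2 ⟨by linarith [hξ.1], hξ.2⟩)
    _ = (11 / 10) * LQ.ev (yT2 (LQ.mul TL TL)) (π ^ 2) + 22 * (rhoBound r X N : ℝ) ^ 2 := by
        have i1 : IntervalIntegrable (fun ξ : ℝ => (11 / 10 : ℝ) * (LQ.ev TL ((π * ξ) ^ 2)) ^ 2) volume (-1) 1 :=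
          (by have := LQ.continuous_ev TL; fun_prop :
            Continuous fun ξ : ℝ => (11 / 10 : ℝ) * (LQ.ev TL ((π * ξ) ^ 2)) ^ 2).intervalIntegrable _ _
        have i2 : IntervalIntegrable (fun _ : ℝ => 11 * (rhoBound r X N : ℝ) ^ 2) volume (-1) 1 :=
          intervalIntegrable_const
        rw [integral_Icc_eq_integral_Ioc, ← intervalIntegral.integral_of_le (by norm_num : (-1 : ℝ) ≤ 1),
          intervalIntegral.integral_add i1 i2, intervalIntegral.integral_const_mul,
          intervalIntegral.integral_const]
        have e : (fun ξ : ℝ => (LQ.ev TL ((π * ξ) ^ 2)) ^ 2) = fun ξ => LQ.ev (LQ.mul TL TL) ((π * ξ) ^ 2) := by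
          funext ξ; rw [LQ.ev_mul, sq]
        rw [e, integral_ev_sq]
        norm_num; ring

/-- **THE BAND ENERGY OF `η_{r,X}` (function form) IS AT MOST `ε`** when the kernel check passes. [folklore] -/
theorem integral_norm_sq_fourier_polyEtaFun_le_of_check (hX : (1 : ℚ) ≤ X) {N S K : ℕ} {eps : ℚ}
    (hc : checkPolyEps r X N S K eps = true) :
    ∫ ξ in Icc (-1 : ℝ) 1, ‖𝓕 (polyEtaFun r X) ξ‖ ^ 2 ≤ ((eps : ℚ) : ℝ) := by
  unfold checkPolyEps at hc
  cases hU : piSqOver16 S K with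
  | none => rw [hU] at hc; exact absurd hc (by simp)
  | some U =>
  rw [hU] at hc
  simp only [Bool.and_eq_true, decide_eq_true_eq] at hc
  obtain ⟨⟨hS0, hN⟩, h⟩ := hc
  have hmem := piSqOver16_mem hS0 hU
  set TL := polyTaylorL r X N
  set H := hornerMI S (scaleList (yT2 (LQ.mul TL TL)) 16) U with hH
  have hS : (0 : ℝ) < S := by exact_mod_cast hS0
  have hev : LQ.ev (yT2 (LQ.mul TL TL)) (π ^ 2) ≤ (H.hi : ℝ) / S := by
    have := le_hi_of_mem_hornerMI hS0 hmem (scaleList (yT2 (LQ.mul TL TL)) 16)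
    rw [ev_scaleList] at this
    push_cast at this
    rw [show (16 : ℝ) * (π ^ 2 / 16) = π ^ 2 by ring] at this
    exact this
  have h' : (11 / 10 : ℝ) * (H.hi : ℝ) + 22 * (rhoBound r X N : ℝ) ^ 2 * S ≤ (eps : ℝ) * S := by
    have h1 := (Rat.cast_le (K := ℝ)).2 h
    push_cast at h1
    exact h1
  refine (integral_norm_sq_fourier_polyEtaFun_le r hX hN).trans ?_
  rw [le_div_iff₀ hS] at hev
  have : ((11 / 10) * LQ.ev (yT2 (LQ.mul TL TL)) (π ^ 2) + 22 * (rhoBound r X N : ℝ) ^ 2) * S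
      ≤ (eps : ℝ) * S := by nlinarith
  exact le_of_mul_le_mul_right this hS

/-- **`hε` OF THE FRAME ENTRY POINT**: if `checkPolyEps r X N ε = true` (`1 ≤ X`), the `L²` Fourier transform of the
class `polyEta r X` has band energy at most `ε` on `[−1, 1]`. [folklore] -/
theorem integral_norm_sq_lpFourier_polyEta_le (hX0 : (0 : ℚ) ≤ X) (hX : (1 : ℚ) ≤ X) {N S K : ℕ} {eps : ℚ}
    (hc : checkPolyEps r X N S K eps = true) :
    ∫ x in Icc (-1 : ℝ) 1, ‖((𝓕 (polyEta r hX0) : Lp ℂ 2 (volume : Measure ℝ)) : ℝ → ℂ) x‖ ^ 2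
      ≤ ((eps : ℚ) : ℝ) := by
  have hae := Literature.Analysis.FunctionSpaces.fourier_toLp_ae_eq_fourierIntegral
    (integrable_polyEtaFun r hX0) (memLp_polyEtaFun r X hX0)
  have hI : ∫ x in Icc (-1 : ℝ) 1, ‖((𝓕 (polyEta r hX0) : Lp ℂ 2 (volume : Measure ℝ)) : ℝ → ℂ) x‖ ^ 2
      = ∫ ξ in Icc (-1 : ℝ) 1, ‖𝓕 (polyEtaFun r X) ξ‖ ^ 2 :=
    integral_congr_ae (ae_restrict_of_ae (hae.mono fun ξ hξ => by simp only [polyEta, hξ]))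
  rw [hI]
  exact integral_norm_sq_fourier_polyEtaFun_le_of_check r hX hc

end Summit.RiemannHypothesis.RiemannHypothesis.SoninPoly

end
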